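import Summits.AnomalousDissipation.AnomalousDissipation.Theorems.SawtoothPulseCascadeK1LocalisedCascadeTrapezoidFejer
import Literature.Analysis.FunctionSpaces.PeriodicLogCost

/-!
# K1loc, line `Spectral` / thin start — helper: SHARP POINTWISE AND TAIL CONSTANTS OF THE TRAPEZOID KERNEL (S-D constants)

Helper file of the prover lane on the crux `K1LocalisedCascade` (stmt-AnomalousDissipation-19491), route
`SawtoothPulseCascade` (S-D fibre ledger; the constants of the half-step, memo v9 §8–§9).  Companion of `…TrapezoidFejer`
(same vocabulary: the trapezoid symbol `χ(m) = min(1, max(0, (L₂ − |m|)/D))`, `D = L₂ − L₁`, kernel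
`k_χ(s) = Σ_{m∈[−L₂,L₂]} χ(m) e_{−m}(s) = (‖S_{L₂}(s)‖² − ‖S_{L₁}(s)‖²)/D`, `S_n(s) = Σ_{m<n} e_{−m}(s)`), which proves
`∫_T |k_χ| ≤ (L₁+L₂)/D`, `|k_χ(s)| ≤ 1/(2D‖s‖²)` and the tail `∫_{‖s‖≥δ}|k_χ| ≤ π/(Dδ)`.  Here the two constants that enter the
junk of the half-step LINEARLY (through the `ε`-socket of `…HalfStepV.sum_window_sq_norm_vstep_le` and the envelope majorant of
memo v9 §9, `c″ = 4c′` with `Tail_ψ(δ) ≤ c′/(Dδ)`) are sharpened by the factors `2` and `2π`: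
* §1 the SINE closed forms at a lift `x` of `s`: `‖S_n(x)‖²·sin²(πx) = sin²(πnx)` (from the telescoping identity of `…FejerKernel`
  and `|e_k − 1| = 2|sin πkx|`), hence `D·k_χ(x)·sin²(πx) = sin(π(L₁+L₂)x)·sin(πDx)` and `|k_χ(x)| ≤ 1/(4Dx²)` on `0 < |x| ≤ ½`
  (Jordan `4x² ≤ sin²(πx)` = `Literature…Torus.four_mul_sq_le_sin_sq`);
* §2 **`norm_trapezoidKernel_le_inv_four_mul_sq`**: `|k_χ(s)| ≤ 1/(4D‖s‖²)` for `s ≠ 0`;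
* §3 the annulus of `ℝ/ℤ` through the fundamental interval: `∫_{δ ≤ ‖s‖} F = ∫_δ^{1−δ} F(x mod 1) dx` (`0 < δ ≤ ½`, any `F`), and
  `∫_{δ≤‖s‖} ds/(4D·max(‖s‖,δ)²) = 1/(2Dδ) − 1/D`;
* §4 **`setIntegral_norm_trapezoidKernel_le_sharp`**: `∫_E |k_χ| ≤ 1/(2Dδ) − 1/D` for every measurable `E ⊆ {δ ≤ ‖s‖}`,
  `0 < δ ≤ ½`; and the `ε`-socket form `2·(2·∫_{w/2≤‖s‖}|k_χ|) ≤ 4/(Dw) − 4/D`.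
(The true tail is `≈ (2/π)·1/(2Dδ)` by averaging the oscillating factor `|sin(π(L₁+L₂)x)|`; the bound here is within `π/2` of it.)
No definitions; no statement about the crux. [cite: Grafakos2014, Prop. 3.1.2 (5), §3.1.3 (Fejér and de la Vallée-Poussin kernels)]
[problem: turb]
-/

-- `Summit.<Summit>.<Problem>`: single-conjunct summit, the duplicate namespace segment is deliberate.
set_option linter.dupNamespace false

noncomputable section

namespace Summit.AnomalousDissipation.AnomalousDissipation.Theorems.SawtoothPulseCascade.K1Window

open MeasureTheory Set Filter Topology Function Complex
open scoped Real

/-! ## §1 Sine closed forms at a lift `x : ℝ` of `s = x mod 1` -/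

/-- `‖e_k(x mod 1) − 1‖ = 2|sin(πkx)|`. [folklore] -/
theorem norm_fourier_coe_sub_one (k : ℤ) (x : ℝ) :
    ‖(fourier k (x : UnitAddCircle) : ℂ) - 1‖ = 2 * |Real.sin (π * k * x)| := by
  rw [fourier_coe_apply]
  have : (2 * ↑π * I * (k : ℂ) * (x : ℂ) / ((1 : ℝ) : ℂ) : ℂ) = I * ((2 * π * k * x : ℝ) : ℂ) := by push_cast; ring
  rw [this, Complex.norm_exp_I_mul_ofReal_sub_one, show (2 * π * k * x : ℝ) / 2 = π * k * x by ring, norm_mul,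
    Real.norm_eq_abs, Real.norm_eq_abs, abs_two]

/-- **Sine form of the Fejér sum**: `‖Σ_{m<n} e_{−m}(x)‖²·sin²(πx) = sin²(πnx)` (from the telescoping identity
`(e_{−1} − 1)·Σ_{m<n} e_{−m} = e_{−n} − 1` and `|e_k − 1| = 2|sin πkx|`). [cite: Grafakos2014, §3.1.3] -/
theorem norm_sq_geomSum_mul_sin_sq (n : ℕ) (x : ℝ) :
    ‖∑ m ∈ Finset.range n, (fourier (-(m : ℤ)) (x : UnitAddCircle) : ℂ)‖ ^ 2 * Real.sin (π * x) ^ 2 =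
      Real.sin (π * n * x) ^ 2 := by
  have h := congrArg (fun z : ℂ => ‖z‖) (fourier_neg_one_sub_one_mul_geom_sum n (x : UnitAddCircle))
  simp only [norm_mul] at h
  rw [norm_fourier_coe_sub_one, norm_fourier_coe_sub_one] at h
  have h1 : |Real.sin (π * ((-1 : ℤ) : ℝ) * x)| = |Real.sin (π * x)| := by
    rw [show π * ((-1 : ℤ) : ℝ) * x = -(π * x) by push_cast; ring, Real.sin_neg, abs_neg]
  have h2 : |Real.sin (π * ((-(n : ℤ) : ℤ) : ℝ) * x)| = |Real.sin (π * n * x)| := by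
    rw [show π * ((-(n : ℤ) : ℤ) : ℝ) * x = -(π * n * x) by push_cast; ring, Real.sin_neg, abs_neg]
  rw [h1, h2] at h
  have h3 := congrArg (fun t : ℝ => t ^ 2) h
  simp only [mul_pow, sq_abs] at h3
  linarith

/-- **Sine form of the trapezoid kernel at a lift**: with `D = L₂ − L₁`,
`D · k(x) · sin²(πx) = sin(π(L₁+L₂)x)·sin(πDx)`, `k(x) = (‖S_{L₂}(x)‖² − ‖S_{L₁}(x)‖²)/D`. [cite: Grafakos2014, §3.1.3] -/
theorem trapezoidKernel_coe_mul_sin_sq (L₁ L₂ : ℕ) (x : ℝ) :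
    (‖∑ m ∈ Finset.range L₂, (fourier (-(m : ℤ)) (x : UnitAddCircle) : ℂ)‖ ^ 2 -
        ‖∑ m ∈ Finset.range L₁, (fourier (-(m : ℤ)) (x : UnitAddCircle) : ℂ)‖ ^ 2) / ((L₂ : ℝ) - L₁) *
      Real.sin (π * x) ^ 2 =
    Real.sin (π * (L₁ + L₂) * x) * Real.sin (π * (L₂ - L₁) * x) / ((L₂ : ℝ) - L₁) := by
  -- `sin²A − sin²B = sin(A+B)·sin(A−B)`
  have hss : ∀ A B : ℝ, Real.sin A ^ 2 - Real.sin B ^ 2 = Real.sin (A + B) * Real.sin (A - B) := by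
    intro A B
    rw [Real.sin_add, Real.sin_sub]
    have hA := Real.sin_sq_add_cos_sq A
    have hB := Real.sin_sq_add_cos_sq B
    linear_combination (-(Real.sin A ^ 2)) * hB + Real.sin B ^ 2 * hA
  rw [div_mul_eq_mul_div, sub_mul, norm_sq_geomSum_mul_sin_sq, norm_sq_geomSum_mul_sin_sq, hss]
  congr 1; ring_nf

/-- **Pointwise decay at a lift**: `|k(x)| ≤ 1/(4Dx²)` for `0 < |x| ≤ ½` — ONE factor of the ramp width `D`, uniform in the
plateau. [cite: Grafakos2014, §3.1.3] -/
theorem abs_trapezoidKernel_coe_le {L₁ L₂ : ℕ} (hL : L₁ < L₂) {x : ℝ} (hx0 : x ≠ 0) (hx : |x| ≤ 1 / 2) :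
    |(‖∑ m ∈ Finset.range L₂, (fourier (-(m : ℤ)) (x : UnitAddCircle) : ℂ)‖ ^ 2 -
        ‖∑ m ∈ Finset.range L₁, (fourier (-(m : ℤ)) (x : UnitAddCircle) : ℂ)‖ ^ 2) / ((L₂ : ℝ) - L₁)| ≤
      1 / (4 * ((L₂ : ℝ) - L₁) * x ^ 2) := by
  have hL' : (L₁ : ℝ) < L₂ := by exact_mod_cast hL
  have hD : (0 : ℝ) < (L₂ : ℝ) - L₁ := by linarith
  have hsin := Literature.Analysis.FunctionSpaces.Torus.four_mul_sq_le_sin_sq hx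
  have hx2 : 0 < x ^ 2 := by positivity
  have hs0 : 0 < Real.sin (π * x) ^ 2 := by linarith
  set k := (‖∑ m ∈ Finset.range L₂, (fourier (-(m : ℤ)) (x : UnitAddCircle) : ℂ)‖ ^ 2 -
      ‖∑ m ∈ Finset.range L₁, (fourier (-(m : ℤ)) (x : UnitAddCircle) : ℂ)‖ ^ 2) / ((L₂ : ℝ) - L₁) with hk
  have hid := trapezoidKernel_coe_mul_sin_sq L₁ L₂ x
  rw [← hk] at hid
  have h1 : |k| * Real.sin (π * x) ^ 2 ≤ 1 / ((L₂ : ℝ) - L₁) := by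
    have : |k| * Real.sin (π * x) ^ 2 =
        |Real.sin (π * (L₁ + L₂) * x) * Real.sin (π * (L₂ - L₁) * x)| / ((L₂ : ℝ) - L₁) := by
      rw [← abs_of_pos hs0, ← abs_mul, hid, abs_div, abs_of_pos hD]
    rw [this, div_le_div_iff_of_pos_right hD, abs_mul]
    exact mul_le_one₀ (Real.abs_sin_le_one _) (abs_nonneg _) (Real.abs_sin_le_one _)
  rw [le_div_iff₀ (by positivity)]
  calc |k| * (4 * ((L₂ : ℝ) - L₁) * x ^ 2) = (|k| * (4 * x ^ 2)) * ((L₂ : ℝ) - L₁) := by ring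
    _ ≤ (|k| * Real.sin (π * x) ^ 2) * ((L₂ : ℝ) - L₁) :=
        mul_le_mul_of_nonneg_right (mul_le_mul_of_nonneg_left hsin (abs_nonneg _)) hD.le
    _ ≤ 1 / ((L₂ : ℝ) - L₁) * ((L₂ : ℝ) - L₁) := mul_le_mul_of_nonneg_right h1 hD.le
    _ = 1 := by field_simp

/-! ## §2 The sharp pointwise bound on the circle -/

section Trapezoid

variable {χ : ℤ → ℂ} {L₁ L₂ : ℕ}

/-- **Pointwise decay, sharp constant**: `|k_χ(s)| ≤ 1/(4D‖s‖²)` for `s ≠ 0` (half of `…TrapezoidFejer.norm_trapezoidKernel_le_inv_sq`,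
from the sine form instead of the triangle inequality between the two Fejér kernels). [cite: Grafakos2014, §3.1.3] -/
theorem norm_trapezoidKernel_le_inv_four_mul_sq (hL : L₁ < L₂)
    (hχ : ∀ m : ℤ, χ m = ((min 1 (max 0 (((L₂ : ℝ) - |(m : ℝ)|) / ((L₂ : ℝ) - L₁))) : ℝ) : ℂ)) {s : UnitAddCircle}
    (hs : 0 < ‖s‖) :
    ‖∑ m ∈ Finset.Icc (-(L₂ : ℤ)) L₂, χ m * fourier (-m) s‖ ≤ 1 / (4 * ((L₂ : ℝ) - L₁) * ‖s‖ ^ 2) := by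
  obtain ⟨x, hx, rfl⟩ : ∃ x : ℝ, x ∈ Ico (-(1 / 2 : ℝ)) (-(1 / 2) + 1) ∧ (x : UnitAddCircle) = s := by
    refine ⟨(AddCircle.equivIco 1 (-(1 / 2)) s : ℝ), (AddCircle.equivIco 1 (-(1 / 2)) s).2, ?_⟩
    exact (AddCircle.equivIco 1 (-(1 / 2))).symm_apply_apply s
  have hxabs : |x| ≤ 1 / 2 := abs_le.mpr ⟨hx.1, by linarith [hx.2]⟩
  have hnorm : ‖(x : UnitAddCircle)‖ = |x| :=
    (AddCircle.norm_coe_eq_abs_iff (1 : ℝ) one_ne_zero).mpr (by simpa using hxabs)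
  have hx0 : x ≠ 0 := by
    rintro rfl
    simp at hs
  rw [trapezoidKernel_eq hL hχ, Complex.norm_real, Real.norm_eq_abs, hnorm, sq_abs]
  exact abs_trapezoidKernel_coe_le hL hx0 hxabs

end Trapezoid


/-! ## §3 Integration over the annulus `{δ ≤ ‖s‖}` of `ℝ/ℤ` through the fundamental interval `[δ, 1 − δ]` -/

/-- For `x ∈ [δ, 1 − δ]` (`0 < δ ≤ ½`) the point `x mod 1` has `‖x mod 1‖ ≥ δ`; for `x ∈ (−δ, δ)` it has `‖x mod 1‖ < δ`:
the trace of the annulus on the fundamental interval `(−δ, 1 − δ]` is `[δ, 1 − δ]`. [folklore] -/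
theorem Ioc_inter_preimage_annulus {δ : ℝ} (hδ : 0 < δ) (hδ' : δ ≤ 1 / 2) :
    Ioc (-δ) (-δ + 1) ∩ (fun x : ℝ => (x : UnitAddCircle)) ⁻¹' {s : UnitAddCircle | δ ≤ ‖s‖} = Icc δ (1 - δ) := by
  ext x
  simp only [mem_inter_iff, mem_Ioc, mem_preimage, mem_setOf_eq, mem_Icc]
  constructor
  · rintro ⟨⟨h1, h2⟩, h3⟩
    refine ⟨?_, by linarith⟩
    by_contra hlt
    push Not at hlt
    have hxabs : |x| ≤ 1 / 2 := abs_le.mpr ⟨by linarith, by linarith⟩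
    have hn : ‖(x : UnitAddCircle)‖ = |x| :=
      (AddCircle.norm_coe_eq_abs_iff (1 : ℝ) one_ne_zero).mpr (by simpa using hxabs)
    rw [hn] at h3
    have : |x| < δ := abs_lt.mpr ⟨h1, hlt⟩
    linarith
  · rintro ⟨h1, h2⟩
    refine ⟨⟨by linarith, by linarith⟩, ?_⟩
    rcases le_or_gt x (1 / 2) with hx | hx
    · have hxabs : |x| ≤ 1 / 2 := abs_le.mpr ⟨by linarith, hx⟩
      have hn : ‖(x : UnitAddCircle)‖ = |x| :=
        (AddCircle.norm_coe_eq_abs_iff (1 : ℝ) one_ne_zero).mpr (by simpa using hxabs)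
      rw [hn, abs_of_pos (hδ.trans_le h1)]
      exact h1
    · -- `x mod 1 = (x − 1) mod 1`, `|x − 1| ≤ ½`
      have hper : ((x - 1 : ℝ) : UnitAddCircle) = (x : UnitAddCircle) := by
        rw [AddCircle.coe_sub, AddCircle.coe_period, sub_zero]
      have hxabs : |x - 1| ≤ 1 / 2 := abs_le.mpr ⟨by linarith, by linarith⟩
      have hn : ‖((x - 1 : ℝ) : UnitAddCircle)‖ = |x - 1| :=
        (AddCircle.norm_coe_eq_abs_iff (1 : ℝ) one_ne_zero).mpr (by simpa using hxabs)
      rw [← hper, hn, abs_of_nonpos (by linarith)]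
      linarith

/-- **Annulus integrals on `ℝ/ℤ` through the fundamental interval**: for `0 < δ ≤ ½` and any `F`,
`∫_{δ ≤ ‖s‖} F(s) ds = ∫_δ^{1−δ} F(x mod 1) dx`. [folklore] -/
theorem setIntegral_annulus_eq_intervalIntegral (F : UnitAddCircle → ℝ) {δ : ℝ} (hδ : 0 < δ) (hδ' : δ ≤ 1 / 2) :
    ∫ s in {s : UnitAddCircle | δ ≤ ‖s‖}, F s = ∫ x in δ..(1 - δ), F (x : UnitAddCircle) := by
  have hA : MeasurableSet {s : UnitAddCircle | δ ≤ ‖s‖} := (isClosed_le continuous_const continuous_norm).measurableSet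
  rw [← integral_indicator hA, ← UnitAddCircle.integral_preimage (-δ)]
  have hind : ∀ x : ℝ, ({s : UnitAddCircle | δ ≤ ‖s‖}).indicator F (x : UnitAddCircle) =
      ((fun y : ℝ => (y : UnitAddCircle)) ⁻¹' {s : UnitAddCircle | δ ≤ ‖s‖}).indicator
        (fun y : ℝ => F (y : UnitAddCircle)) x := fun x => (Set.indicator_comp_right _).symm
  simp_rw [hind]
  have hmk : Measurable fun y : ℝ => (y : UnitAddCircle) := (AddCircle.continuous_mk' (1 : ℝ)).measurable
  have hpre : MeasurableSet ((fun y : ℝ => (y : UnitAddCircle)) ⁻¹' {s : UnitAddCircle | δ ≤ ‖s‖}) := hA.preimage hmk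
  rw [setIntegral_indicator hpre, Ioc_inter_preimage_annulus hδ hδ', integral_Icc_eq_integral_Ioc,
    ← intervalIntegral.integral_of_le (by linarith)]

/-- `∫_δ^{½} dx/x² = 1/δ − 2` for `0 < δ ≤ ½`. [folklore] -/
theorem intervalIntegral_inv_sq {δ : ℝ} (hδ : 0 < δ) (hδ' : δ ≤ 1 / 2) :
    ∫ x in δ..(1 / 2 : ℝ), 1 / x ^ 2 = 1 / δ - 2 := by
  have hderiv : ∀ x ∈ uIcc δ (1 / 2 : ℝ), HasDerivAt (fun x : ℝ => x⁻¹) (-(x ^ 2)⁻¹) x := by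
    intro x hx
    rw [uIcc_of_le hδ'] at hx
    exact hasDerivAt_inv (hδ.trans_le hx.1).ne'
  have hcont : ContinuousOn (fun x : ℝ => -(x ^ 2)⁻¹) (uIcc δ (1 / 2 : ℝ)) := by
    refine (continuousOn_pow 2).inv₀ (fun x hx => ?_) |>.neg
    rw [uIcc_of_le hδ'] at hx
    exact pow_ne_zero 2 (hδ.trans_le hx.1).ne'
  have key := intervalIntegral.integral_eq_sub_of_hasDerivAt hderiv hcont.intervalIntegrable
  have e : ∫ x in δ..(1 / 2 : ℝ), 1 / x ^ 2 = -∫ x in δ..(1 / 2 : ℝ), -(x ^ 2)⁻¹ := by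
    rw [← intervalIntegral.integral_neg]
    refine intervalIntegral.integral_congr fun x _ => ?_
    simp only [neg_neg, one_div]
  rw [e, key]
  field_simp; ring

/-- **The annulus integral of `1/(4D·max(‖s‖,δ)²)`**: `= 1/(2Dδ) − 1/D` for `0 < δ ≤ ½`. [folklore] -/
theorem setIntegral_annulus_inv_sq {D δ : ℝ} (hD : 0 < D) (hδ : 0 < δ) (hδ' : δ ≤ 1 / 2) :
    ∫ s in {s : UnitAddCircle | δ ≤ ‖s‖}, 1 / (4 * D * max ‖s‖ δ ^ 2) = 1 / (2 * D * δ) - 1 / D := by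
  rw [setIntegral_annulus_eq_intervalIntegral _ hδ hδ']
  set G : ℝ → ℝ := fun x => 1 / (4 * D * max ‖(x : UnitAddCircle)‖ δ ^ 2) with hG
  have hGc : Continuous G := by
    refine continuous_const.div (continuous_const.mul ((continuous_norm.comp (AddCircle.continuous_mk' (1 : ℝ))).max
      continuous_const |>.pow 2)) fun x => ?_
    have : δ ≤ max ‖(x : UnitAddCircle)‖ δ := le_max_right _ _
    positivity
  -- symmetry `x ↦ 1 − x`
  have hsymm : ∀ x : ℝ, G (1 - x) = G x := by
    intro x
    simp only [hG]
    rw [AddCircle.coe_sub, AddCircle.coe_period, zero_sub, norm_neg]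
  have hsplit : ∫ x in δ..(1 - δ), G x = (∫ x in δ..(1 / 2 : ℝ), G x) + ∫ x in (1 / 2 : ℝ)..(1 - δ), G x :=
    (intervalIntegral.integral_add_adjacent_intervals (hGc.intervalIntegrable _ _) (hGc.intervalIntegrable _ _)).symm
  have hsecond : ∫ x in (1 / 2 : ℝ)..(1 - δ), G x = ∫ x in δ..(1 / 2 : ℝ), G x := by
    have h := intervalIntegral.integral_comp_sub_left G (1 : ℝ) (a := δ) (b := 1 / 2)
    simp_rw [hsymm] at h
    rw [show (1 : ℝ) - 1 / 2 = 1 / 2 by norm_num] at h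
    exact h.symm
  -- on `[δ, ½]`: `G(x) = 1/(4Dx²)`
  have hfirst : ∫ x in δ..(1 / 2 : ℝ), G x = 1 / (4 * D) * (1 / δ - 2) := by
    rw [← intervalIntegral_inv_sq hδ hδ', ← intervalIntegral.integral_const_mul]
    refine intervalIntegral.integral_congr fun x hx => ?_
    rw [uIcc_of_le hδ'] at hx
    have hxabs : |x| ≤ 1 / 2 := abs_le.mpr ⟨by linarith [hx.1], hx.2⟩
    have hn : ‖(x : UnitAddCircle)‖ = |x| :=
      (AddCircle.norm_coe_eq_abs_iff (1 : ℝ) one_ne_zero).mpr (by simpa using hxabs)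
    simp only [hG]
    rw [hn, abs_of_pos (hδ.trans_le hx.1), max_eq_left hx.1]
    have hx0 : x ≠ 0 := (hδ.trans_le hx.1).ne'
    field_simp
  rw [hsplit, hsecond, hfirst]
  field_simp
  ring

/-! ## §4 The sharp tail of the trapezoid kernel -/

section Trapezoid

variable {χ : ℤ → ℂ} {L₁ L₂ : ℕ}

/-- **Tail of the trapezoid kernel, sharp constant**: for `0 < δ ≤ ½` and any measurable `E ⊆ {δ ≤ ‖s‖}`,
`∫_E |k_χ| ≤ 1/(2Dδ) − 1/D` (`D = L₂ − L₁`) — versus `π/(Dδ)` in `…TrapezoidFejer.setIntegral_norm_trapezoidKernel_le`.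
(Pointwise `|k_χ(s)| ≤ 1/(4D‖s‖²)` integrated exactly over the annulus.) [cite: Grafakos2014, §3.1.3] -/
theorem setIntegral_norm_trapezoidKernel_le_sharp (hL : L₁ < L₂)
    (hχ : ∀ m : ℤ, χ m = ((min 1 (max 0 (((L₂ : ℝ) - |(m : ℝ)|) / ((L₂ : ℝ) - L₁))) : ℝ) : ℂ)) {δ : ℝ} (hδ : 0 < δ)
    (hδ' : δ ≤ 1 / 2) {E : Set UnitAddCircle} (hEm : MeasurableSet E) (hE : ∀ s ∈ E, δ ≤ ‖s‖) :
    ∫ s in E, ‖∑ m ∈ Finset.Icc (-(L₂ : ℤ)) L₂, χ m * fourier (-m) s‖ ≤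
      1 / (2 * ((L₂ : ℝ) - L₁) * δ) - 1 / ((L₂ : ℝ) - L₁) := by
  have hL' : (L₁ : ℝ) < L₂ := by exact_mod_cast hL
  have hD : (0 : ℝ) < (L₂ : ℝ) - L₁ := by linarith
  have hI : ∀ {f : UnitAddCircle → ℝ}, Continuous f → Integrable f := fun hf =>
    hf.integrable_of_hasCompactSupport (HasCompactSupport.of_compactSpace _)
  have hkc : Continuous fun s : UnitAddCircle => ‖∑ m ∈ Finset.Icc (-(L₂ : ℤ)) L₂, χ m * fourier (-m) s‖ :=
    continuous_norm.comp (continuous_finsetSum _ fun m _ => continuous_const.mul (fourier (-m)).continuous)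
  set g : UnitAddCircle → ℝ := fun s => 1 / (4 * ((L₂ : ℝ) - L₁) * max ‖s‖ δ ^ 2) with hg
  have hgc : Continuous g := by
    refine continuous_const.div (continuous_const.mul ((continuous_norm.max continuous_const).pow 2)) fun s => ?_
    have : δ ≤ max ‖s‖ δ := le_max_right _ _
    positivity
  have hg0 : ∀ s, 0 ≤ g s := fun s => by
    simp only [hg]
    have : δ ≤ max ‖s‖ δ := le_max_right _ _
    positivity
  have hA : MeasurableSet {s : UnitAddCircle | δ ≤ ‖s‖} := (isClosed_le continuous_const continuous_norm).measurableSet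
  -- on `E`: `|k(s)| ≤ 1/(4D‖s‖²) = g(s)`
  have hpt : ∀ s ∈ E, ‖∑ m ∈ Finset.Icc (-(L₂ : ℤ)) L₂, χ m * fourier (-m) s‖ ≤ g s := by
    intro s hs
    have hsδ := hE s hs
    have hs0 : 0 < ‖s‖ := hδ.trans_le hsδ
    refine (norm_trapezoidKernel_le_inv_four_mul_sq hL hχ hs0).trans_eq ?_
    simp only [hg]
    rw [max_eq_left hsδ]
  calc ∫ s in E, ‖∑ m ∈ Finset.Icc (-(L₂ : ℤ)) L₂, χ m * fourier (-m) s‖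
      ≤ ∫ s in E, g s := setIntegral_mono_on (hI hkc).integrableOn (hI hgc).integrableOn hEm hpt
    _ ≤ ∫ s in {s : UnitAddCircle | δ ≤ ‖s‖}, g s :=
        setIntegral_mono_set (hI hgc).integrableOn (Eventually.of_forall hg0) (Eventually.of_forall fun s hs => hE s hs)
    _ = 1 / (2 * ((L₂ : ℝ) - L₁) * δ) - 1 / ((L₂ : ℝ) - L₁) := setIntegral_annulus_inv_sq hD hδ hδ'

/-- **The `ε`-socket of `…HalfStepV.sum_window_sq_norm_vstep_le`** for a trapezoid mid-band symbol: with layer width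
`0 < w ≤ 1`, `2·(2·∫_{w/2 ≤ ‖s‖} |k_χ|) ≤ 4/(Dw) − 4/D (≤ 4/(Dw))`. [cite: Grafakos2014, §3.1.3] -/
theorem two_mul_two_mul_setIntegral_norm_trapezoidKernel_le (hL : L₁ < L₂)
    (hχ : ∀ m : ℤ, χ m = ((min 1 (max 0 (((L₂ : ℝ) - |(m : ℝ)|) / ((L₂ : ℝ) - L₁))) : ℝ) : ℂ)) {w : ℝ} (hw : 0 < w)
    (hw' : w ≤ 1) :
    2 * (2 * ∫ s in {s : UnitAddCircle | w / 2 ≤ ‖s‖}, ‖∑ m ∈ Finset.Icc (-(L₂ : ℤ)) L₂, χ m * fourier (-m) s‖) ≤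
      4 / (((L₂ : ℝ) - L₁) * w) - 4 / ((L₂ : ℝ) - L₁) := by
  have hL' : (L₁ : ℝ) < L₂ := by exact_mod_cast hL
  have hD : (0 : ℝ) < (L₂ : ℝ) - L₁ := by linarith
  have hA : MeasurableSet {s : UnitAddCircle | w / 2 ≤ ‖s‖} := (isClosed_le continuous_const continuous_norm).measurableSet
  have h := setIntegral_norm_trapezoidKernel_le_sharp hL hχ (by positivity : 0 < w / 2) (by linarith) hA fun s hs => hs
  have e : 1 / (2 * ((L₂ : ℝ) - L₁) * (w / 2)) - 1 / ((L₂ : ℝ) - L₁) = 1 / (((L₂ : ℝ) - L₁) * w) - 1 / ((L₂ : ℝ) - L₁) := by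
    congr 1
    field_simp
  rw [e] at h
  have : 4 / (((L₂ : ℝ) - L₁) * w) - 4 / ((L₂ : ℝ) - L₁) = 2 * (2 * (1 / (((L₂ : ℝ) - L₁) * w) - 1 / ((L₂ : ℝ) - L₁))) := by
    field_simp
    ring
  rw [this]
  exact mul_le_mul_of_nonneg_left (mul_le_mul_of_nonneg_left h zero_le_two) zero_le_two

end Trapezoid

end Summit.AnomalousDissipation.AnomalousDissipation.Theorems.SawtoothPulseCascade.K1Window
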